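import Mathlib
import HarnessLib

/-!
# Adjugates and one-dimensional kernels

Topic `Literature/LinearAlgebra/Matrix`, namespace `Literature.LinearAlgebra.Matrix`. Elementary
facts relating the adjugate of a square matrix over an integral domain / field to its kernel, in the
form needed for rank-semicontinuity arguments ("the kernel is a line generically if it is a line at
one point"): two non-proportional kernel vectors kill the adjugate
(`adjugate_eq_zero_of_mulVec_of_mulVec`), hence a nonzero adjugate makes any two (left or right)
kernel vectors proportional (`mulVec_proportional_of_adjugate_ne_zero`,
`vecMul_proportional_of_adjugate_ne_zero`); rows/columns of the adjugate of a singular matrix are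
kernel vectors; and conversely, over a field, **if the left kernel is contained in a line then the
adjugate is nonzero** (`adjugate_ne_zero_of_vecMul_line`, through the transvection normal form
`M = P · diag D · Q` of `Mathlib.LinearAlgebra.Matrix.Transvection`). All statements are for an
arbitrary finite index type. [folklore]
-/

namespace Literature.LinearAlgebra.Matrix

/-! ### Adjugates and one-dimensional kernels (linear algebra over an integral domain) -/

section Adjugate

open _root_.Matrix

variable {n : Type*} [Fintype n] [DecidableEq n] {A : Type*} [CommRing A] [IsDomain A]

/-- A nonzero kernel vector vanishing at `i` kills the `(i, ·)` entries of the adjugate. [folklore] -/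
theorem adjugate_apply_eq_zero_of_mulVec (M : Matrix n n A) {x : n → A} (hx : M *ᵥ x = 0) {i : n}
    (hxi : x i = 0) (hx0 : x ≠ 0) (j : n) : adjugate M i j = 0 := by
  rw [adjugate_apply, ← exists_mulVec_eq_zero_iff]
  refine ⟨x, hx0, ?_⟩
  rw [updateRow_mulVec, hx, dotProduct_comm, dotProduct_single_one, hxi]
  exact Function.update_eq_self j (0 : n → A)

/-- **Two non-proportional kernel vectors kill the adjugate.** [folklore] -/
theorem adjugate_eq_zero_of_mulVec_of_mulVec (M : Matrix n n A) {x y : n → A} (hx : M *ᵥ x = 0)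
    (hy : M *ᵥ y = 0) (hxy : ∃ k, y k • x ≠ x k • y) : adjugate M = 0 := by
  obtain ⟨k, hk⟩ := hxy
  have hx0 : x ≠ 0 := by
    rintro rfl
    exact hk (by rw [smul_zero, Pi.zero_apply, zero_smul])
  ext i j
  rw [Matrix.zero_apply]
  by_cases hxi : x i = 0
  · exact adjugate_apply_eq_zero_of_mulVec M hx hxi hx0 j
  · -- the combination `x i • y - y i • x` is a kernel vector vanishing at `i`; it is nonzero,
    -- for otherwise `x` and `y` would be proportional
    refine adjugate_apply_eq_zero_of_mulVec M (x := x i • y - y i • x) ?_ ?_ ?_ j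
    · rw [mulVec_sub, mulVec_smul, mulVec_smul, hx, hy, smul_zero, smul_zero, sub_zero]
    · simp [mul_comm]
    · intro h
      apply hk
      have hprop : x i • y = y i • x := sub_eq_zero.1 h
      -- `x i • (y k • x) = y k • (x i • x)` and `x i • (x k • y) = x k • (y i • x)`; compare via `hprop`
      apply smul_right_injective (n → A) hxi
      funext l
      have h1 := congrArg (fun v : n → A => v k) hprop
      have h2 := congrArg (fun v : n → A => v l) hprop
      simp only [Pi.smul_apply, smul_eq_mul] at h1 h2 ⊢
      -- goal: x i * (y k * x l) = x i * (x k * y l)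
      calc x i * (y k * x l) = (x i * y k) * x l := by ring
        _ = (y i * x k) * x l := by rw [h1]
        _ = x k * (y i * x l) := by ring
        _ = x k * (x i * y l) := by rw [h2]
        _ = x i * (x k * y l) := by ring

/-- **If the adjugate is nonzero, the kernel is at most a line**: any two kernel vectors are
proportional. [folklore] -/
theorem mulVec_proportional_of_adjugate_ne_zero (M : Matrix n n A) (hM : adjugate M ≠ 0) {x y : n → A}
    (hx : M *ᵥ x = 0) (hy : M *ᵥ y = 0) (k : n) : y k • x = x k • y := by
  by_contra h
  exact hM (adjugate_eq_zero_of_mulVec_of_mulVec M hx hy ⟨k, h⟩)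

/-- The same for left kernel vectors (`x ᵥ* M = 0`). [folklore] -/
theorem vecMul_proportional_of_adjugate_ne_zero (M : Matrix n n A) (hM : adjugate M ≠ 0) {x y : n → A}
    (hx : x ᵥ* M = 0) (hy : y ᵥ* M = 0) (k : n) : y k • x = x k • y := by
  have hM' : adjugate Mᵀ ≠ 0 := by
    rw [← adjugate_transpose]
    intro h
    exact hM (by simpa using congrArg Matrix.transpose h)
  exact mulVec_proportional_of_adjugate_ne_zero Mᵀ hM' (by rwa [mulVec_transpose])
    (by rwa [mulVec_transpose]) k

omit [IsDomain A] in
/-- Columns of the adjugate of a singular matrix are kernel vectors. [folklore] -/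
theorem mulVec_adjugate_col (M : Matrix n n A) (hM : M.det = 0) (j : n) :
    M *ᵥ (fun i => adjugate M i j) = 0 := by
  have h := mul_adjugate M
  rw [hM, zero_smul] at h
  funext i
  have := congrArg (fun N : Matrix n n A => N i j) h
  simpa [Matrix.mul_apply, mulVec, dotProduct] using this

omit [IsDomain A] in
/-- Rows of the adjugate of a singular matrix are left kernel vectors. [folklore] -/
theorem adjugate_row_vecMul (M : Matrix n n A) (hM : M.det = 0) (i : n) :
    (fun j => adjugate M i j) ᵥ* M = 0 := by
  have h := adjugate_mul M
  rw [hM, zero_smul] at h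
  funext j
  have := congrArg (fun N : Matrix n n A => N i j) h
  simpa [Matrix.mul_apply, vecMul, dotProduct] using this

end Adjugate

/-! ### A line of left kernel vectors forces a nonzero adjugate (over a field) -/

section NullityOne

open _root_.Matrix

variable {n : Type*} [Fintype n] [DecidableEq n] {K : Type*} [Field K]

/-- The adjugate of a diagonal matrix with two zero entries... conversely: **if the adjugate of a
diagonal matrix vanishes, the diagonal has two distinct zeros** (given the index type is
nonempty). [folklore] -/
theorem exists_two_zeros_of_adjugate_diagonal_eq_zero (D : n → K) (i₀ : n)
    (h : adjugate (diagonal D) = 0) : ∃ j₁ j₂, j₁ ≠ j₂ ∧ D j₁ = 0 ∧ D j₂ = 0 := by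
  rw [adjugate_diagonal] at h
  have hz : ∀ i, ∃ j, j ≠ i ∧ D j = 0 := by
    intro i
    have hi := congrArg (fun N : Matrix n n K => N i i) h
    simp only [diagonal_apply_eq, Matrix.zero_apply] at hi
    obtain ⟨j, hj, hj0⟩ := Finset.prod_eq_zero_iff.1 hi
    exact ⟨j, (Finset.mem_erase.1 hj).1, hj0⟩
  obtain ⟨j₁, -, hj₁⟩ := hz i₀
  obtain ⟨j₂, hne, hj₂⟩ := hz j₁
  exact ⟨j₁, j₂, hne.symm, hj₁, hj₂⟩

/-- **Nullity one forces a nonzero adjugate**: if every left kernel vector of `M` is a multiple of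
a single vector `v₀`, then `adjugate M ≠ 0` (proof through the transvection normal form
`M = P · diag D · Q`). [folklore] -/
theorem adjugate_ne_zero_of_vecMul_line (M : Matrix n n K) (v₀ : n → K)
    (hH : ∀ x : n → K, x ᵥ* M = 0 → ∃ a : K, x = a • v₀) (i₀ : n) : adjugate M ≠ 0 := by
  obtain ⟨L, L', D, hM⟩ := Pivot.exists_list_transvec_mul_diagonal_mul_list_transvec M
  set P := (L.map TransvectionStruct.toMatrix).prod with hP
  set Q := (L'.map TransvectionStruct.toMatrix).prod with hQ
  have hdP : P.det = 1 := TransvectionStruct.det_toMatrix_prod L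
  have hdQ : Q.det = 1 := TransvectionStruct.det_toMatrix_prod L'
  have hPinv : adjugate P * P = 1 := by rw [adjugate_mul, hdP, one_smul]
  have hQinv : Q * adjugate Q = 1 := by rw [mul_adjugate, hdQ, one_smul]
  intro h0
  -- then the adjugate of the diagonal part vanishes
  have hD : adjugate (diagonal D) = 0 := by
    have h1 : adjugate M = adjugate Q * adjugate (diagonal D) * adjugate P := by
      rw [hM, adjugate_mul_distrib, adjugate_mul_distrib, Matrix.mul_assoc]
    have h2 : Q * adjugate M * P = adjugate (diagonal D) := by
      rw [h1, ← Matrix.mul_assoc, ← Matrix.mul_assoc, hQinv, Matrix.one_mul, Matrix.mul_assoc, hPinv,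
        Matrix.mul_one]
    rw [← h2, h0, Matrix.mul_zero, Matrix.zero_mul]
  obtain ⟨j₁, j₂, hne, hj₁, hj₂⟩ := exists_two_zeros_of_adjugate_diagonal_eq_zero D i₀ hD
  -- two independent left kernel vectors of `M`: `e_j ᵥ* adj P` for `j = j₁, j₂`
  have hker : ∀ j, D j = 0 → (Pi.single j (1 : K) ᵥ* adjugate P) ᵥ* M = 0 := by
    intro j hj
    rw [hM, Matrix.mul_assoc, ← vecMul_vecMul, vecMul_vecMul _ (adjugate P), hPinv, vecMul_one,
      ← vecMul_vecMul, single_vecMul_diagonal, one_mul, hj, Pi.single_zero, zero_vecMul]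
  obtain ⟨a, ha⟩ := hH _ (hker j₁ hj₁)
  obtain ⟨b, hb⟩ := hH _ (hker j₂ hj₂)
  -- undo `adj P`: `e_j = (a • v₀) ᵥ* P`
  have hPinv' : adjugate P * P = 1 := hPinv
  have ha' : Pi.single j₁ (1 : K) = a • (v₀ ᵥ* P) := by
    have := congrArg (fun x => x ᵥ* P) ha
    simpa only [vecMul_vecMul, hPinv', vecMul_one, Matrix.smul_vecMul] using this
  have hb' : Pi.single j₂ (1 : K) = b • (v₀ ᵥ* P) := by
    have := congrArg (fun x => x ᵥ* P) hb
    simpa only [vecMul_vecMul, hPinv', vecMul_one, Matrix.smul_vecMul] using this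
  -- evaluate at `j₁` and `j₂`
  have h11 := congrFun ha' j₁
  have h12 := congrFun ha' j₂
  have h21 := congrFun hb' j₁
  have h22 := congrFun hb' j₂
  simp only [Pi.single_eq_same, Pi.single_eq_of_ne hne, Pi.single_eq_of_ne hne.symm, Pi.smul_apply,
    smul_eq_mul] at h11 h12 h21 h22
  -- `1 = a u₁`, `0 = a u₂`, `0 = b u₁`, `1 = b u₂` with `u = v₀ P`: impossible
  have ha0 : a ≠ 0 := by rintro rfl; simp at h11
  have hb0 : b ≠ 0 := by rintro rfl; simp at h22
  have hu1 : (v₀ ᵥ* P) j₁ = 0 := by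
    rcases mul_eq_zero.1 h21.symm with h | h
    · exact absurd h hb0
    · exact h
  rw [hu1, mul_zero] at h11
  exact one_ne_zero h11

end NullityOne

end Literature.LinearAlgebra.Matrix
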